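import Mathlib

/-!
# X193 kernel, layer C (F13): the Sylvester–Vandermonde evaluation determinant

Solo-informed Schanuel programme, X193 kernel (DESIGN `work/s213/X193-KERNEL-DESIGN.md`,
Amendment A17).  Layer C removes the hypothesis `Roy2010.prop_3_1` from THEOREM X193-K by
proving in the tree the only instance the kernel uses: Roy's Proposition 3.1 at `t = 1` for a
coprime pair (D. Roy, *Small value estimates for the additive group*, Int. J. Number Theory
6 (2010), §3).  This file is the linear-algebra core of Roy's Lemma 3.4 at `t = 1`, over `ℂ`
and with no arithmetic input:

* `soloX_norm_det_le_weights`: the Leibniz bound `‖det M‖ ≤ (#ι)! (∏ ρ) (∏ c)` for a matrix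
  with `‖M i j‖ ≤ ρ i · c j` (row weights `ρ`, column scales `c`);
* `soloX_sylvester_apply`: the entries of Mathlib's Sylvester matrix `sylvester p q a b` are
  the coefficients of the column polynomials `X ^ j · q` (`j < a`) and `X ^ j · p` (`j < b`);
* `soloX_vandermonde_coeff_det_le`, `soloX_vandermonde_resultant_le`: for `s ≤ a + b` points
  `ξ`, multiplying the Sylvester matrix on the left by the block matrix
  `[[Vandermonde ξ, (ξ_r ^ (s + c))], [0, 1]]` replaces the first `s` coefficient rows by the
  VALUE rows `(X ^ j q)(ξ_r)`, `(X ^ j p)(ξ_r)`; the Leibniz bound then gives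
  `‖det Vandermonde ξ‖ · ‖Res (p, q)‖ ≤ (a+b)! · (∏ ρ_r) · κ ^ (a+b-s) · cq ^ a · cp ^ b`
  from pointwise bounds `‖ξ_r ^ j q(ξ_r)‖ ≤ ρ_r cq`, `‖ξ_r ^ j p(ξ_r)‖ ≤ ρ_r cp` and (only
  when coefficient rows remain) `‖coeff q‖ ≤ κ cq`, `‖coeff p‖ ≤ κ cp`;
* `soloX_norm_det_vandermonde`, `soloX_prod_offDiag_sqrt_eq`: `‖det Vandermonde ξ‖` as the
  product of the mutual distances, in the `∏_{i<j}` and in the ordered-pairs `√·` forms.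

No definitions (the column polynomials are an inline `Fin.addCases`).
-/

namespace Summit.Schanuel.Schanuel.Theorems

open Polynomial Finset Matrix

/-! ## The weighted Leibniz bound -/

/-- Leibniz bound with row weights and column scales: if `‖M i j‖ ≤ ρ i * c j` for all
`i, j`, then `‖det M‖ ≤ (#ι)! * ((∏ i, ρ i) * ∏ j, c j)`. -/
theorem soloX_norm_det_le_weights {ι : Type*} [Fintype ι] [DecidableEq ι] (M : Matrix ι ι ℂ)
    {ρ c : ι → ℝ} (hM : ∀ i j, ‖M i j‖ ≤ ρ i * c j) :
    ‖M.det‖ ≤ (Fintype.card ι).factorial * ((∏ i, ρ i) * ∏ j, c j) := by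
  have hterm : ∀ σ : Equiv.Perm ι,
      ‖((Equiv.Perm.sign σ : ℤ) : ℂ) * ∏ i, M (σ i) i‖ ≤ (∏ i, ρ i) * ∏ j, c j := by
    intro σ
    have h1 : ‖((Equiv.Perm.sign σ : ℤ) : ℂ)‖ = 1 := by
      rcases Int.units_eq_one_or (Equiv.Perm.sign σ) with h | h <;> simp [h]
    rw [norm_mul, h1, one_mul, Complex.norm_prod, ← Equiv.prod_comp σ ρ,
      ← Finset.prod_mul_distrib]
    exact Finset.prod_le_prod (fun i _ => norm_nonneg _) fun i _ => hM _ _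
  rw [Matrix.det_apply']
  calc ‖∑ σ : Equiv.Perm ι, ((Equiv.Perm.sign σ : ℤ) : ℂ) * ∏ i, M (σ i) i‖
      ≤ ∑ σ : Equiv.Perm ι, ‖((Equiv.Perm.sign σ : ℤ) : ℂ) * ∏ i, M (σ i) i‖ :=
        norm_sum_le _ _
    _ ≤ ∑ _σ : Equiv.Perm ι, (∏ i, ρ i) * ∏ j, c j := Finset.sum_le_sum fun σ _ => hterm σ
    _ = (Fintype.card ι).factorial * ((∏ i, ρ i) * ∏ j, c j) := by
        rw [Finset.sum_const, Finset.card_univ, Fintype.card_perm, nsmul_eq_mul]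

/-! ## The Sylvester matrix: columns are shifted copies of `q` and `p` -/

/-- The entries of the Sylvester matrix `sylvester p q a b` (`deg p ≤ a`, `deg q ≤ b`):
column `j < a` holds the coefficients of `X ^ j * q`, column `a + j` (`j < b`) those of
`X ^ j * p`. -/
theorem soloX_sylvester_apply {R : Type*} [CommRing R] (p q : R[X]) {a b : ℕ}
    (hp : p.natDegree ≤ a) (hq : q.natDegree ≤ b) (i j : Fin (a + b)) :
    sylvester p q a b i j =
      (Fin.addCases (fun j₁ : Fin a => X ^ (j₁ : ℕ) * q)
        (fun j₁ : Fin b => X ^ (j₁ : ℕ) * p) j : R[X]).coeff i := by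
  induction j using Fin.addCases with
  | left j₁ =>
    by_cases h1 : (j₁ : ℕ) ≤ (i : ℕ)
    · by_cases h2 : (i : ℕ) ≤ j₁ + b
      · simp [sylvester, h1, h2, coeff_X_pow_mul']
      · have h0 : q.coeff (i - j₁) = 0 := coeff_eq_zero_of_natDegree_lt (by omega)
        simp [sylvester, h1, h2, coeff_X_pow_mul', h0]
    · simp [sylvester, h1, coeff_X_pow_mul']
  | right j₁ =>
    by_cases h1 : (j₁ : ℕ) ≤ (i : ℕ)
    · by_cases h2 : (i : ℕ) ≤ j₁ + a
      · simp [sylvester, h1, h2, coeff_X_pow_mul']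
      · have h0 : p.coeff (i - j₁) = 0 := coeff_eq_zero_of_natDegree_lt (by omega)
        simp [sylvester, h1, h2, coeff_X_pow_mul', h0]
    · simp [sylvester, h1, coeff_X_pow_mul']

/-! ## The evaluation matrix and its determinant bound -/

/-- Splitting the coefficient sum of `f (x)` (`deg f < s + k`) into the first `s` powers and
the remaining `k`. -/
theorem soloX_eval_split {f : ℂ[X]} {s k : ℕ} (hf : f.natDegree < s + k) (x : ℂ) :
    ∑ r : Fin s, x ^ (r : ℕ) * f.coeff r + ∑ c : Fin k, x ^ (s + c) * f.coeff (s + c) =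
      f.eval x := by
  rw [eval_eq_sum_range' hf, ← Fin.sum_univ_eq_sum_range (fun i => f.coeff i * x ^ i) (s + k),
    Fin.sum_univ_add]
  simp only [Fin.val_castAdd, Fin.val_natAdd, mul_comm]

/-- **Evaluation-determinant bound.**  Let `S` be an `N × N` matrix whose `j`-th column is
the coefficient vector of a polynomial `P j` of degree `< N`, `N = s + k`, and `ξ` be `s`
points.  If `‖(P j)(ξ_r)‖ ≤ ρ r * c j` for all `r, j`, and (when `k ≠ 0`)
`‖coeff_i (P j)‖ ≤ κ * c j` for all `i, j`, then
`‖det Vandermonde ξ‖ * ‖det S‖ ≤ N! * ((∏ r, ρ r) * κ ^ k * ∏ j, c j)` (multiply `S` on the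
left by `[[Vandermonde ξ, ξ_r ^ (s + c)], [0, 1]]` and apply the weighted Leibniz bound). -/
theorem soloX_vandermonde_coeff_det_le {s k N : ℕ} (hN : s + k = N) (P : Fin N → ℂ[X])
    (hP : ∀ j, (P j).natDegree < N) (S : Matrix (Fin N) (Fin N) ℂ)
    (hS : ∀ i j, S i j = (P j).coeff i) (ξ : Fin s → ℂ) {ρ : Fin s → ℝ} {κ : ℝ}
    {c : Fin N → ℝ} (heval : ∀ r j, ‖(P j).eval (ξ r)‖ ≤ ρ r * c j)
    (hcoeff : k ≠ 0 → ∀ i j, ‖(P j).coeff i‖ ≤ κ * c j) :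
    ‖(vandermonde ξ).det‖ * ‖S.det‖ ≤ N.factorial * ((∏ r, ρ r) * κ ^ k * ∏ j, c j) := by
  classical
  subst hN
  set L : Matrix (Fin s ⊕ Fin k) (Fin s ⊕ Fin k) ℂ :=
    Matrix.fromBlocks (vandermonde ξ) (Matrix.of fun r c' => ξ r ^ (s + (c' : ℕ))) 0 1
    with hL
  set S' : Matrix (Fin s ⊕ Fin k) (Fin s ⊕ Fin k) ℂ :=
    S.submatrix finSumFinEquiv finSumFinEquiv with hS'
  have hdet : (vandermonde ξ).det * S.det = (L * S').det := by
    rw [Matrix.det_mul, hL, Matrix.det_fromBlocks_zero₂₁, Matrix.det_one, mul_one, hS',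
      Matrix.det_submatrix_equiv_self]
  have hrow : ∀ (r : Fin s) (j' : Fin s ⊕ Fin k),
      (L * S') (Sum.inl r) j' = (P (finSumFinEquiv j')).eval (ξ r) := by
    intro r j'
    rw [Matrix.mul_apply, Fintype.sum_sum_type]
    simp only [hL, hS', Matrix.fromBlocks_apply₁₁, Matrix.fromBlocks_apply₁₂,
      vandermonde_apply, Matrix.of_apply, Matrix.submatrix_apply, hS,
      finSumFinEquiv_apply_left, finSumFinEquiv_apply_right, Fin.val_castAdd,
      Fin.val_natAdd]
    exact soloX_eval_split (hP _) _
  have hcoe : ∀ (c' : Fin k) (j' : Fin s ⊕ Fin k),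
      (L * S') (Sum.inr c') j' = (P (finSumFinEquiv j')).coeff (s + c') := by
    intro c' j'
    rw [Matrix.mul_apply, Fintype.sum_sum_type]
    simp [hL, hS', Matrix.one_apply, hS]
  have hentry : ∀ i' j', ‖(L * S') i' j'‖ ≤
      Sum.elim ρ (fun _ => κ) i' * c (finSumFinEquiv j') := by
    rintro (r | c') j'
    · rw [hrow, Sum.elim_inl]
      exact heval r _
    · rw [hcoe, Sum.elim_inr]
      exact hcoeff (Fin.pos c').ne' _ _
  have hmain := soloX_norm_det_le_weights (L * S') (ρ := Sum.elim ρ fun _ => κ)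
    (c := fun j' => c (finSumFinEquiv j')) hentry
  rw [Fintype.card_sum, Fintype.card_fin, Fintype.card_fin, Fintype.prod_sum_type,
    Equiv.prod_comp finSumFinEquiv c] at hmain
  simp only [Sum.elim_inl, Sum.elim_inr, Finset.prod_const, Finset.card_univ,
    Fintype.card_fin] at hmain
  rw [← norm_mul, hdet]
  exact hmain

/-- **Evaluation-determinant bound for the resultant** (Roy's Lemma 3.4 at `t = 1`, in
bound form).  `deg p ≤ a`, `deg q ≤ b`, `s + k = a + b`, `ξ` any `s` points; if
`‖ξ_r ^ j q(ξ_r)‖ ≤ ρ r * cq` (`j < a`), `‖ξ_r ^ j p(ξ_r)‖ ≤ ρ r * cp` (`j < b`) and, when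
`k ≠ 0`, `‖coeff q‖ ≤ κ cq`, `‖coeff p‖ ≤ κ cp`, then
`‖det Vandermonde ξ‖ * ‖Res_{a,b} (p, q)‖ ≤ (a+b)! * ((∏ r, ρ r) * κ ^ k * (cq ^ a * cp ^ b))`. -/
theorem soloX_vandermonde_resultant_le (p q : ℂ[X]) {a b s k : ℕ} (hp : p.natDegree ≤ a)
    (hq : q.natDegree ≤ b) (hk : s + k = a + b) (ξ : Fin s → ℂ) {ρ : Fin s → ℝ}
    {cp cq κ : ℝ} (hcp : 0 ≤ cp) (hcq : 0 ≤ cq) (hκ : 0 ≤ κ)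
    (hq_eval : ∀ r, ∀ j : ℕ, j < a → ‖ξ r ^ j * q.eval (ξ r)‖ ≤ ρ r * cq)
    (hp_eval : ∀ r, ∀ j : ℕ, j < b → ‖ξ r ^ j * p.eval (ξ r)‖ ≤ ρ r * cp)
    (hq_coeff : k ≠ 0 → ∀ i, ‖q.coeff i‖ ≤ κ * cq)
    (hp_coeff : k ≠ 0 → ∀ i, ‖p.coeff i‖ ≤ κ * cp) :
    ‖(vandermonde ξ).det‖ * ‖resultant p q a b‖ ≤
      (a + b).factorial * ((∏ r, ρ r) * κ ^ k * (cq ^ a * cp ^ b)) := by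
  have hprod : ∏ j : Fin (a + b),
      (Fin.addCases (fun _ : Fin a => cq) (fun _ : Fin b => cp) j : ℝ) = cq ^ a * cp ^ b := by
    rw [Fin.prod_univ_add]
    simp
  rw [← hprod, resultant]
  refine soloX_vandermonde_coeff_det_le hk
    (fun j => (Fin.addCases (fun j₁ : Fin a => X ^ (j₁ : ℕ) * q)
      (fun j₁ : Fin b => X ^ (j₁ : ℕ) * p) j : ℂ[X]))
    ?_ (sylvester p q a b) (soloX_sylvester_apply p q hp hq) ξ
    (c := fun j => (Fin.addCases (fun _ : Fin a => cq) (fun _ : Fin b => cp) j : ℝ))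
    ?_ ?_
  · intro j
    induction j using Fin.addCases with
    | left j₁ =>
      rw [Fin.addCases_left]
      calc (X ^ (j₁ : ℕ) * q).natDegree ≤ (X ^ (j₁ : ℕ) : ℂ[X]).natDegree + q.natDegree :=
            natDegree_mul_le
        _ ≤ j₁ + b := add_le_add (natDegree_X_pow_le _) hq
        _ < a + b := by have := j₁.isLt; omega
    | right j₁ =>
      rw [Fin.addCases_right]
      calc (X ^ (j₁ : ℕ) * p).natDegree ≤ (X ^ (j₁ : ℕ) : ℂ[X]).natDegree + p.natDegree :=
            natDegree_mul_le
        _ ≤ j₁ + a := add_le_add (natDegree_X_pow_le _) hp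
        _ < a + b := by have := j₁.isLt; omega
  · intro r j
    induction j using Fin.addCases with
    | left j₁ =>
      rw [Fin.addCases_left, Fin.addCases_left, eval_mul, eval_pow, eval_X]
      exact hq_eval r j₁ j₁.isLt
    | right j₁ =>
      rw [Fin.addCases_right, Fin.addCases_right, eval_mul, eval_pow, eval_X]
      exact hp_eval r j₁ j₁.isLt
  · intro hk0 i j
    induction j using Fin.addCases with
    | left j₁ =>
      rw [Fin.addCases_left, Fin.addCases_left, coeff_X_pow_mul']
      split_ifs
      · exact hq_coeff hk0 _
      · rw [norm_zero]; exact mul_nonneg hκ hcq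
    | right j₁ =>
      rw [Fin.addCases_right, Fin.addCases_right, coeff_X_pow_mul']
      split_ifs
      · exact hp_coeff hk0 _
      · rw [norm_zero]; exact mul_nonneg hκ hcp

/-! ## The Vandermonde determinant as the product of mutual distances -/

/-- `‖det Vandermonde ξ‖ = ∏_{i < j} ‖ξ_j − ξ_i‖`. -/
theorem soloX_norm_det_vandermonde {s : ℕ} (ξ : Fin s → ℂ) :
    ‖(vandermonde ξ).det‖ = ∏ i : Fin s, ∏ j ∈ Ioi i, ‖ξ j - ξ i‖ := by
  rw [Matrix.det_vandermonde, Complex.norm_prod]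
  exact Finset.prod_congr rfl fun i _ => Complex.norm_prod _ _

/-- Ordered-pairs form: `∏_{(i, j), i ≠ j} ‖ξ_i − ξ_j‖^{1/2} = ‖det Vandermonde ξ‖` (the
shape of Roy's `Δ_E`, [Roy2010, eq. (3.1)]). -/
theorem soloX_prod_offDiag_sqrt_eq {s : ℕ} (ξ : Fin s → ℂ) :
    ∏ x ∈ (univ : Finset (Fin s)).offDiag, Real.sqrt ‖ξ x.1 - ξ x.2‖ =
      ‖(vandermonde ξ).det‖ := by
  rw [soloX_norm_det_vandermonde,
    ← Finset.prod_filter_mul_prod_filter_not univ.offDiag (fun x => x.1 < x.2)]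
  have hswap : ∏ x ∈ univ.offDiag with ¬ (x.1 < x.2), Real.sqrt ‖ξ x.1 - ξ x.2‖ =
      ∏ x ∈ (univ : Finset (Fin s)).offDiag with x.1 < x.2, Real.sqrt ‖ξ x.2 - ξ x.1‖ := by
    refine Finset.prod_bij' (fun x _ => x.swap) (fun x _ => x.swap) ?_ ?_ (fun x _ => rfl)
      (fun x _ => rfl) (fun x _ => rfl)
    · intro x hx
      simp only [Finset.mem_filter, Finset.mem_offDiag, Finset.mem_univ, true_and] at hx ⊢
      exact ⟨hx.1.symm, lt_of_le_of_ne (not_lt.mp hx.2) hx.1.symm⟩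
    · intro x hx
      simp only [Finset.mem_filter, Finset.mem_offDiag, Finset.mem_univ, true_and] at hx ⊢
      exact ⟨hx.1.symm, not_lt.mpr hx.2.le⟩
  rw [hswap, ← Finset.prod_mul_distrib]
  have hmul : ∀ x : Fin s × Fin s,
      Real.sqrt ‖ξ x.1 - ξ x.2‖ * Real.sqrt ‖ξ x.2 - ξ x.1‖ = ‖ξ x.2 - ξ x.1‖ := by
    intro x
    rw [norm_sub_rev (ξ x.1), Real.mul_self_sqrt (norm_nonneg _)]
  simp_rw [hmul]
  refine Finset.prod_finset_product' (s := univ) (t := fun i : Fin s => Ioi i)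
    (f := fun i j : Fin s => ‖ξ j - ξ i‖) _ (fun x => ?_)
  simp only [Finset.mem_filter, Finset.mem_offDiag, Finset.mem_univ, true_and, Finset.mem_Ioi]
  exact ⟨fun h => h.2, fun h => ⟨h.ne, h⟩⟩

end Summit.Schanuel.Schanuel.Theorems
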